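import Summits.BirchSwinnertonDyer.Rank1Residual.F1Sign2.UnitPlaneExtraspecialCoverAtTwo
import HarnessLib

/-!
# DESC-46 kernel (typer -ty g22): -desc g36's PROVED glue and g0 non-vacuity lemmas for `F1Sign2/UnitPlaneExtraspecialCoverAtTwo.lean` (Sketch46 7d8086391eed1f80, VERBATIM)

CONTENT (all PROVED, no `sorry`, no `def`): glue `heisenbergGoverning_of_extraspecial : UnitPlaneExtraspecialGoverningFieldAtTwo → UnitPlaneHeisenbergGoverningFieldAtTwo` (C′;
with the tree's `congruentIncrementPrime_of_governing` it reaches DESC-45-Cp); non-vacuity of D46.1 at (`g0` = `X³ − 7X − 5`, `p = 11`, roots `1, 2, 8`):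
`mulMatrixCubic_g0a/_g0b`, `det_mulMatrixCubic_g0a/_g0b`, `isIntegralUnitQuot_g0a/_g0b`, `labelledRoots_g0_11`, `evalModC_unitG0a/_unitG0b`, `normOneUnitResidueRankTwo_g0_11`;
non-vacuity of DESC-46-R's hypotheses for `g0`: `mulMatrixCubic_g0ab`, `det_mulMatrixCubic_g0ab`, `isIntegralUnitQuot_g0ab`, `evalModC_unitG0ab`,
`unitPairResidueIndependent_g0_11`, `redeiNormEquation_g0`, and -desc's closing `example`; + REF1 g24's §325 probe section `…F1Sign2.REF1_325` VERBATIM from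
`REF1-data/b325/Probe325.lean` f95b8531b1d07f89 (minus `#print axioms`): K325.1/K325.2 junk branches of D46.3, K325.3 `p ∤ ka·kb` automatic, K325.4a–c relabelling invariance,
K325.5 `cubicG0_irreducible_rat` (mod-2 + Gauss), K325.6 `desc46R_hypotheses_g0` (all 11 hypotheses of 46-R at g0), K325.7 `desc46R_at_g0` (modus ponens).  BSD is not proved by
this; 23715 is not closed by this.
-/

noncomputable section
open scoped Classical Polynomial
open Polynomial WeierstrassCurve IsDedekindDomain NumberField

namespace Summit.BirchSwinnertonDyer.Rank1Residual.F1Sign2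

/-! ### Glue (PROVED) -/

/-- (-desc g36 `MEMO-desc-data/g36/lean/Sketch46.lean` 7d8086391eed1f80, VERBATIM.) glue (PROVED): DESC-46-A projects onto C′ = DESC-45-M (REF1 R312a form), hence (tree kernel `congruentIncrementPrime_of_governing`) onto DESC-45-Cp. -/
theorem heisenbergGoverning_of_extraspecial (h : UnitPlaneExtraspecialGoverningFieldAtTwo) : UnitPlaneHeisenbergGoverningFieldAtTwo := by
  intro c hm hd hirr
  obtain ⟨M, hF, hN, hG, hdeg, hspl, hram, hlaw⟩ := h c hm hd hirr
  exact ⟨M, hF, hN, hG, hdeg, hspl, hram, fun W _ _ _ xnum xden B2 B4 B6 hW => (hlaw W xnum xden B2 B4 B6 hW).1⟩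

/-! ### Non-vacuity of D46.1: `c = X³ − 7X − 5` (`g0`, `Δ_L = 697 = 17·41`, `ℤ[θ] = 𝓞_L`), `p = 11`, roots `1, 2, 8`; `u₁ = θ² − θ − 6 = (θ − 3)(θ + 2)`, `u₂ = −θ − 2`,
both of norm `+1`; residues: `u₁ ↦ (5, 7, 6)` = (□, non-□, non-□), `u₂ ↦ (8, 7, 1)` = (non-□, non-□, □) mod 11: sign vectors `(0,1,1)`, `(1,1,0)` — rank 2. -/

/-- (-desc g36 `MEMO-desc-data/g36/lean/Sketch46.lean` 7d8086391eed1f80, VERBATIM.) `M_{u₁} = −6·1 − C + C²` (`C` the companion matrix of `X³ − 7X − 5`). -/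
theorem mulMatrixCubic_g0a : mulMatrixCubic cubicG0 unitG0a = !![-6, 5, -5; -1, 1, -2; 1, -1, 1] := by
  ext i j
  fin_cases i <;> fin_cases j <;>
    simp [-zsmul_eq_mul, mulMatrixCubic, companionCubic, cubicG0, unitG0a, sq, Matrix.ofNat_apply, Matrix.neg_apply, coeff_X_pow, coeff_X]

/-- (-desc g36 `MEMO-desc-data/g36/lean/Sketch46.lean` 7d8086391eed1f80, VERBATIM.) `M_{u₂} = −2·1 − C`. -/
theorem mulMatrixCubic_g0b : mulMatrixCubic cubicG0 unitG0b = !![-2, 0, -5; -1, -2, -7; 0, -1, -2] := by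
  ext i j
  fin_cases i <;> fin_cases j <;>
    simp [-zsmul_eq_mul, mulMatrixCubic, companionCubic, cubicG0, unitG0b, sq, Matrix.ofNat_apply, Matrix.neg_apply, coeff_X_pow, coeff_X]

/-- (-desc g36 `MEMO-desc-data/g36/lean/Sketch46.lean` 7d8086391eed1f80, VERBATIM.) -/
theorem det_mulMatrixCubic_g0a : (mulMatrixCubic cubicG0 unitG0a).det = 1 := by
  rw [mulMatrixCubic_g0a, Matrix.det_fin_three]; simp

/-- (-desc g36 `MEMO-desc-data/g36/lean/Sketch46.lean` 7d8086391eed1f80, VERBATIM.) -/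
theorem det_mulMatrixCubic_g0b : (mulMatrixCubic cubicG0 unitG0b).det = 1 := by
  rw [mulMatrixCubic_g0b, Matrix.det_fin_three]; simp

/-- (-desc g36 `MEMO-desc-data/g36/lean/Sketch46.lean` 7d8086391eed1f80, VERBATIM.) -/
theorem isIntegralUnitQuot_g0a : IsIntegralUnitQuot cubicG0 unitG0a 1 := by
  refine ⟨Nat.one_pos, ?_, ?_, ?_⟩
  · unfold unitG0a; compute_degree!
  · intro i _; simp
  · rw [det_mulMatrixCubic_g0a]; simp

/-- (-desc g36 `MEMO-desc-data/g36/lean/Sketch46.lean` 7d8086391eed1f80, VERBATIM.) -/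
theorem isIntegralUnitQuot_g0b : IsIntegralUnitQuot cubicG0 unitG0b 1 := by
  refine ⟨Nat.one_pos, ?_, ?_, ?_⟩
  · unfold unitG0b; compute_degree!
  · intro i _; simp
  · rw [det_mulMatrixCubic_g0b]; simp

/-- (-desc g36 `MEMO-desc-data/g36/lean/Sketch46.lean` 7d8086391eed1f80, VERBATIM.) -/
theorem labelledRoots_g0_11 : LabelledRootsModC cubicG0 11 rootsG0mod11 := by
  refine ⟨?_, ?_⟩
  · unfold rootsG0mod11; decide
  · intro j; fin_cases j <;> simp [rootsG0mod11, evalModC, cubicG0] <;> decide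

/-- (-desc g36 `MEMO-desc-data/g36/lean/Sketch46.lean` 7d8086391eed1f80, VERBATIM.) -/
theorem evalModC_unitG0a (x : ZMod 11) : evalModC unitG0a 11 x = x ^ 2 - x - 6 := by
  simp [evalModC, unitG0a]

/-- (-desc g36 `MEMO-desc-data/g36/lean/Sketch46.lean` 7d8086391eed1f80, VERBATIM.) -/
theorem evalModC_unitG0b (x : ZMod 11) : evalModC unitG0b 11 x = -x - 2 := by
  simp [evalModC, unitG0b]

/-- (-desc g36 `MEMO-desc-data/g36/lean/Sketch46.lean` 7d8086391eed1f80, VERBATIM.) **D46.1 is inhabited**: the unit residue map of `x³ − 7x − 5` at `p = 11` has rank 2 (witness `i = 2` (root 8), `j = 0` (root 1), `u = u₁`, `v = u₂`, `k = 1`). -/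
theorem normOneUnitResidueRankTwo_g0_11 : NormOneUnitResidueRankTwoC cubicG0 11 rootsG0mod11 := by
  refine ⟨unitG0a, unitG0b, 1, 1, 2, 0, by decide, isIntegralUnitQuot_g0a, by rw [det_mulMatrixCubic_g0a]; norm_num, by norm_num,
    isIntegralUnitQuot_g0b, by rw [det_mulMatrixCubic_g0b]; norm_num, by norm_num, ?_, ?_, ?_, ?_⟩
  · rw [evalModC_unitG0a]; simp [rootsG0mod11]; decide
  · rw [evalModC_unitG0a]; simp [rootsG0mod11]; decide
  · rw [evalModC_unitG0b]; simp [rootsG0mod11]; decide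
  · rw [evalModC_unitG0b]; simp [rootsG0mod11]; decide

/-! ### Non-vacuity of the hypotheses of DESC-46-R for `g0`: `a = u₁`, `b = u₁u₂ = 1 − u₁ = −θ² + θ + 7` (totally positive; an EXCEPTIONAL-UNIT relation `u₁ + u₁u₂ = 1`),
so `θ_R := 1 + √u₁` solves `N(θ_R) = 1 − u₁ = b` (`X0 = X1 = 1`, `m = 1`; this is PARI's `rnfisnorm` solution, ENGINE 59 row `THETA| g0 u1`), and CONJECTURE 46.4 for this field reads:
`δ_W(q) = 0 ⟺ 1 + w is a square in 𝔽_q[x]/(x³ − 7x − 5), w² = x² − x − 6` — confirmed at all 150 rigid primes of the §44 census (kit j338430/j338444, `d = 1`). -/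

/-- (-desc g36 `MEMO-desc-data/g36/lean/Sketch46.lean` 7d8086391eed1f80, VERBATIM.) -/
theorem mulMatrixCubic_g0ab : mulMatrixCubic cubicG0 unitG0ab = !![7, -5, 5; 1, 0, 2; -1, 1, 0] := by
  ext i j
  fin_cases i <;> fin_cases j <;>
    simp [-zsmul_eq_mul, mulMatrixCubic, companionCubic, cubicG0, unitG0ab, sq, Matrix.ofNat_apply, coeff_X_pow, coeff_X]

/-- (-desc g36 `MEMO-desc-data/g36/lean/Sketch46.lean` 7d8086391eed1f80, VERBATIM.) -/
theorem det_mulMatrixCubic_g0ab : (mulMatrixCubic cubicG0 unitG0ab).det = 1 := by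
  rw [mulMatrixCubic_g0ab, Matrix.det_fin_three]; simp

/-- (-desc g36 `MEMO-desc-data/g36/lean/Sketch46.lean` 7d8086391eed1f80, VERBATIM.) -/
theorem isIntegralUnitQuot_g0ab : IsIntegralUnitQuot cubicG0 unitG0ab 1 := by
  refine ⟨Nat.one_pos, ?_, ?_, ?_⟩
  · unfold unitG0ab; compute_degree!
  · intro i _; simp
  · rw [det_mulMatrixCubic_g0ab]; simp

/-- (-desc g36 `MEMO-desc-data/g36/lean/Sketch46.lean` 7d8086391eed1f80, VERBATIM.) -/
theorem evalModC_unitG0ab (x : ZMod 11) : evalModC unitG0ab 11 x = -x ^ 2 + x + 7 := by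
  simp [evalModC, unitG0ab]

/-- (-desc g36 `MEMO-desc-data/g36/lean/Sketch46.lean` 7d8086391eed1f80, VERBATIM.) D46.2 is inhabited: `u₁ ↦ (5, 7, 6)` = (□, non-□, non-□) and `u₁u₂ ↦ (7, 5, 6)` = (non-□, □, non-□) mod 11 at the roots `(1, 2, 8)`: independent (witness `i = 1`, `j = 0`). -/
theorem unitPairResidueIndependent_g0_11 : UnitPairResidueIndependentC cubicG0 unitG0a unitG0ab 1 1 11 rootsG0mod11 := by
  refine ⟨labelledRoots_g0_11, 1, 0, by decide, ?_, ?_, ?_, ?_⟩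
  · rw [evalModC_unitG0a]; simp [rootsG0mod11]; decide
  · rw [evalModC_unitG0a]; simp [rootsG0mod11]; decide
  · rw [evalModC_unitG0ab]; simp [rootsG0mod11]; decide
  · rw [evalModC_unitG0ab]; simp [rootsG0mod11]; decide

/-- (-desc g36 `MEMO-desc-data/g36/lean/Sketch46.lean` 7d8086391eed1f80, VERBATIM.) the norm equation `x₀² − u₁x₁² = u₁u₂` with `x₀ = x₁ = 1`, `m = 1`: `1·1·1 − 1·u₁·1 − 1·1·(u₁u₂) = 0` in `ℤ[X]` (so divisible by `c`). -/
theorem redeiNormEquation_g0 :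
    cubicG0 ∣ C ((1 : ℕ) * (1 : ℕ) : ℤ) * (1 : ℤ[X]) ^ 2 - C ((1 : ℕ) : ℤ) * unitG0a * (1 : ℤ[X]) ^ 2 - C (((1 : ℕ) : ℤ) ^ 2 * (1 : ℕ)) * unitG0ab := by
  have h : C ((1 : ℕ) * (1 : ℕ) : ℤ) * (1 : ℤ[X]) ^ 2 - C ((1 : ℕ) : ℤ) * unitG0a * (1 : ℤ[X]) ^ 2 - C (((1 : ℕ) : ℤ) ^ 2 * (1 : ℕ)) * unitG0ab = 0 := by
    simp only [unitG0a, unitG0ab, Nat.cast_one, mul_one, one_pow, map_one, one_mul, map_ofNat]; ring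
  rw [h]; exact dvd_zero _

/-- (-desc g36 `MEMO-desc-data/g36/lean/Sketch46.lean` 7d8086391eed1f80, VERBATIM.) **All hypotheses of DESC-46-R are met by** `(c, Ga, Gb, X0, X1, ka, kb, m, p₀, a₀) = (x³−7x−5, x²−x−6, −x²+x+7, 1, 1, 1, 1, 1, 11, (1,2,8))` (irreducibility over `ℚ` apart,
which the tree proves for its own cubics by `decide`-style kernels and is not repeated here). -/
example : cubicG0.Monic ∧ cubicG0.natDegree = 3 ∧ IsIntegralUnitQuot cubicG0 unitG0a 1 ∧ (mulMatrixCubic cubicG0 unitG0a).det = ((1 : ℕ) : ℤ) ^ 3 ∧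
    IsIntegralUnitQuot cubicG0 unitG0ab 1 ∧ (mulMatrixCubic cubicG0 unitG0ab).det = ((1 : ℕ) : ℤ) ^ 3 ∧ (11 : ℕ).Prime ∧
    UnitPairResidueIndependentC cubicG0 unitG0a unitG0ab 1 1 11 rootsG0mod11 ∧ 0 < 1 ∧
    cubicG0 ∣ C ((1 : ℕ) * (1 : ℕ) : ℤ) * (1 : ℤ[X]) ^ 2 - C ((1 : ℕ) : ℤ) * unitG0a * (1 : ℤ[X]) ^ 2 - C (((1 : ℕ) : ℤ) ^ 2 * (1 : ℕ)) * unitG0ab := by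
  refine ⟨?_, ?_, isIntegralUnitQuot_g0a, by rw [det_mulMatrixCubic_g0a]; norm_num, isIntegralUnitQuot_g0ab, by rw [det_mulMatrixCubic_g0ab]; norm_num, by norm_num,
    unitPairResidueIndependent_g0_11, Nat.one_pos, redeiNormEquation_g0⟩
  · unfold cubicG0; monicity!
  · unfold cubicG0; compute_degree!

/-! ## REF1 §325 probe section (`REF1-data/b325/Probe325.lean` f95b8531b1d07f89, bsd-f1-sign2-ref1 g24; typer -ty g22: VERBATIM minus the six `#print axioms` lines —
REF1 offered K325.5–K325.7 for this kernel (R325c) and K325.3/K325.4 as optional hygiene; all taken; REF1 wrote it appended to -desc g36 `Sketch46.lean` (sha16 7d8086391eed1f80)).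
Kernel lemmas on the §46 carriers: vacuity branch of D46.3, `p ∤ ka·kb` is automatic in D46.2, labelling invariance of D46.1/`LabelledRootsModC`,
and irreducibility of the non-vacuity cubic `g0 = X³ − 7X − 5` over `ℚ` (completing -desc's hypothesis bundle for DESC-46-R). -/

namespace REF1_325

/-- K325.1 (vacuity branch of D46.3).  If `Ga·ka` is NOT a square in `𝔽_q[x]/(c)`, `RedeiResidueIsSquareC` holds for want of a `w`.
(At a rigid — inert — `q ∤ ka` this never happens: `N_{L/ℚ}(a) = 1 ⟹ ā^{(q³−1)/2} = (ā^{q²+q+1})^{(q−1)/2} = 1`, LEMMA 45.2; REF1 engine: 0 failures in 48 600 rows.) -/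
theorem redeiResidue_of_not_isSquare (c Ga X0 X1 : ℤ[X]) (ka q : ℕ)
    (h : ¬ IsSquare (AdjoinRoot.mk (c.map (Int.castRingHom (ZMod q))) ((Ga * C (ka : ℤ)).map (Int.castRingHom (ZMod q))))) :
    RedeiResidueIsSquareC c Ga X0 X1 ka q := by
  intro w hw
  exact absurd ⟨w, by rw [← hw]; exact sq w⟩ h

/-- K325.2 (junk branch of D46.3 at `q ∣ ka`): `w := 0` satisfies the premise and the conclusion is `IsSquare 0`-shaped — so in the FIELD case
(`c` irreducible mod `q`, the only `w` is `0`) the predicate is junk-TRUE at the finitely many `q ∣ ka`; the row's `∃ r` (with `ka ∣ r`) absorbs them. -/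
theorem redeiResidue_premise_at_dvd (c Ga : ℤ[X]) (ka q : ℕ) (hq : q ∣ ka) :
    (0 : AdjoinRoot (c.map (Int.castRingHom (ZMod q)))) ^ 2 =
      AdjoinRoot.mk (c.map (Int.castRingHom (ZMod q))) ((Ga * C (ka : ℤ)).map (Int.castRingHom (ZMod q))) := by
  have hka : ((ka : ℤ) : ZMod q) = 0 := by exact_mod_cast (CharP.cast_eq_zero_iff (ZMod q) q ka).mpr hq
  rw [Polynomial.map_mul, Polynomial.map_C, eq_intCast, hka, map_zero, mul_zero, map_zero]
  ring

/-- K325.2 (REF1, second half): at `q ∣ ka` the conclusion of D46.3 holds with `w := 0`. -/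
theorem redeiResidue_conclusion_at_dvd (c X0 X1 : ℤ[X]) (ka q : ℕ) (hq : q ∣ ka) :
    IsSquare (AdjoinRoot.mk (c.map (Int.castRingHom (ZMod q))) ((C (ka : ℤ) * X0).map (Int.castRingHom (ZMod q))) +
        AdjoinRoot.mk (c.map (Int.castRingHom (ZMod q))) (X1.map (Int.castRingHom (ZMod q))) * 0) := by
  have hka : ((ka : ℤ) : ZMod q) = 0 := by exact_mod_cast (CharP.cast_eq_zero_iff (ZMod q) q ka).mpr hq
  rw [Polynomial.map_mul, Polynomial.map_C, eq_intCast, hka, map_zero, zero_mul, map_zero, mul_zero, add_zero]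
  exact ⟨0, (mul_zero _).symm⟩

/-- K325.3: the two `¬ IsSquare` clauses of D46.2 force `p ∤ ka` and `p ∤ kb` (else the residue is `0`, a square) — no separate side condition needed. -/
theorem not_dvd_of_unitPairResidueIndependent {c Ga Gb : ℤ[X]} {ka kb p : ℕ} {a : Fin 3 → ZMod p}
    (h : UnitPairResidueIndependentC c Ga Gb ka kb p a) : ¬ p ∣ ka ∧ ¬ p ∣ kb := by
  obtain ⟨_, i, j, _, hai, _, _, hbj⟩ := h
  refine ⟨fun hp => hai ?_, fun hp => hbj ?_⟩
  · rw [(CharP.cast_eq_zero_iff (ZMod p) p ka).mpr hp, mul_zero]; exact ⟨0, (mul_zero _).symm⟩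
  · rw [(CharP.cast_eq_zero_iff (ZMod p) p kb).mpr hp, mul_zero]; exact ⟨0, (mul_zero _).symm⟩

/-- K325.4a: `LabelledRootsModC` is invariant under relabelling. -/
theorem labelledRoots_comp_equiv {c : ℤ[X]} {p : ℕ} {a : Fin 3 → ZMod p} (σ : Equiv.Perm (Fin 3))
    (h : LabelledRootsModC c p a) : LabelledRootsModC c p (a ∘ σ) :=
  ⟨h.1.comp σ.injective, fun j => h.2 (σ j)⟩

/-- K325.4b: D46.1 is invariant under relabelling (its `∃ i ≠ j` is label-free), so the label-free left side `DoorResidueDegree M p 4` of DESC-46-A's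
`f = 4` clause is compared with a label-free right side although the clause binds `∀ a`. -/
theorem normOneUnitResidueRankTwo_comp_equiv {c : ℤ[X]} {p : ℕ} {a : Fin 3 → ZMod p} (σ : Equiv.Perm (Fin 3))
    (h : NormOneUnitResidueRankTwoC c p a) : NormOneUnitResidueRankTwoC c p (a ∘ σ) := by
  obtain ⟨g₁, g₂, k₁, k₂, i, j, hij, h1, h2, h3, h4, h5, h6, h7, h8, h9, h10⟩ := h
  refine ⟨g₁, g₂, k₁, k₂, σ.symm i, σ.symm j, fun e => hij (σ.symm.injective e), h1, h2, h3, h4, h5, h6, ?_, ?_, ?_, ?_⟩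
  · simpa only [Function.comp_apply, Equiv.apply_symm_apply] using h7
  · simpa only [Function.comp_apply, Equiv.apply_symm_apply] using h8
  · simpa only [Function.comp_apply, Equiv.apply_symm_apply] using h9
  · simpa only [Function.comp_apply, Equiv.apply_symm_apply] using h10

/-- K325.4c: likewise D46.2. -/
theorem unitPairResidueIndependent_comp_equiv {c Ga Gb : ℤ[X]} {ka kb p : ℕ} {a : Fin 3 → ZMod p} (σ : Equiv.Perm (Fin 3))
    (h : UnitPairResidueIndependentC c Ga Gb ka kb p a) : UnitPairResidueIndependentC c Ga Gb ka kb p (a ∘ σ) := by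
  obtain ⟨hl, i, j, hij, h1, h2, h3, h4⟩ := h
  refine ⟨labelledRoots_comp_equiv σ hl, σ.symm i, σ.symm j, fun e => hij (σ.symm.injective e), ?_, ?_, ?_, ?_⟩
  · simpa only [Function.comp_apply, Equiv.apply_symm_apply] using h1
  · simpa only [Function.comp_apply, Equiv.apply_symm_apply] using h2
  · simpa only [Function.comp_apply, Equiv.apply_symm_apply] using h3
  · simpa only [Function.comp_apply, Equiv.apply_symm_apply] using h4

/-! ### K325.5: `g0 = X³ − 7X − 5` is irreducible over `ℚ` (mod-2 reduction `X³ + X + 1` has no root in `𝔽₂`; Gauss). -/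

/-- K325.5 (REF1): `g0` is monic. -/
theorem cubicG0_monic : cubicG0.Monic := by unfold cubicG0; monicity!

/-- K325.5 (REF1): `g0` has degree 3. -/
theorem cubicG0_natDegree : cubicG0.natDegree = 3 := by unfold cubicG0; compute_degree!

/-- K325.5 (REF1): evaluation of `g0` over `𝔽₂`. -/
theorem cubicG0_eval₂_zmod2 (x : ZMod 2) : cubicG0.eval₂ (Int.castRingHom (ZMod 2)) x = x ^ 3 - 7 * x - 5 := by
  simp [cubicG0, eval₂_sub, eval₂_mul, eval₂_X_pow, eval₂_X]

/-- K325.5 (REF1): `g0 mod 2 = X³ + X + 1` is irreducible over `𝔽₂` (no root; degree ≤ 3). -/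
theorem cubicG0_map_two_irreducible : Irreducible (cubicG0.map (Int.castRingHom (ZMod 2))) := by
  have hm : (cubicG0.map (Int.castRingHom (ZMod 2))).Monic := cubicG0_monic.map _
  have hd : (cubicG0.map (Int.castRingHom (ZMod 2))).natDegree = 3 := by
    rw [cubicG0_monic.natDegree_map, cubicG0_natDegree]
  rw [hm.irreducible_iff_roots_eq_zero_of_degree_le_three (by omega) (by omega), Multiset.eq_zero_iff_forall_notMem]
  intro x hx
  rw [Polynomial.mem_roots hm.ne_zero, Polynomial.IsRoot, Polynomial.eval_map, cubicG0_eval₂_zmod2] at hx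
  revert hx; revert x; decide

/-- K325.5 (REF1): hence `g0` is irreducible over `ℤ` (Gauss / reduction mod 2). -/
theorem cubicG0_irreducible_int : Irreducible cubicG0 :=
  Monic.irreducible_of_irreducible_map (Int.castRingHom (ZMod 2)) cubicG0 cubicG0_monic cubicG0_map_two_irreducible

/-- K325.5: the missing conjunct of -desc's non-vacuity bundle. -/
theorem cubicG0_irreducible_rat : Irreducible (cubicG0.map (Int.castRingHom ℚ)) := by
  rw [← algebraMap_int_eq]
  exact (cubicG0_monic.irreducible_iff_irreducible_map_fraction_map (K := ℚ)).mp cubicG0_irreducible_int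

/-- K325.6: ALL hypotheses of DESC-46-R (irreducibility INCLUDED) at `(x³−7x−5, x²−x−6, −x²+x+7, 1, 1, 1, 1, 1, 11, (1,2,8))` — the row is not vacuous in its
`∀`-prefix (the seed binder is inhabited by -desc's census seeds of field g0, not re-checked in Lean). -/
theorem desc46R_hypotheses_g0 : cubicG0.Monic ∧ cubicG0.natDegree = 3 ∧ Irreducible (cubicG0.map (Int.castRingHom ℚ)) ∧
    IsIntegralUnitQuot cubicG0 unitG0a 1 ∧ (mulMatrixCubic cubicG0 unitG0a).det = ((1 : ℕ) : ℤ) ^ 3 ∧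
    IsIntegralUnitQuot cubicG0 unitG0ab 1 ∧ (mulMatrixCubic cubicG0 unitG0ab).det = ((1 : ℕ) : ℤ) ^ 3 ∧ (11 : ℕ).Prime ∧
    UnitPairResidueIndependentC cubicG0 unitG0a unitG0ab 1 1 11 rootsG0mod11 ∧ 0 < 1 ∧
    cubicG0 ∣ C ((1 : ℕ) * (1 : ℕ) : ℤ) * (1 : ℤ[X]) ^ 2 - C ((1 : ℕ) : ℤ) * unitG0a * (1 : ℤ[X]) ^ 2 - C (((1 : ℕ) : ℤ) ^ 2 * (1 : ℕ)) * unitG0ab :=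
  ⟨cubicG0_monic, cubicG0_natDegree, cubicG0_irreducible_rat, isIntegralUnitQuot_g0a, by rw [det_mulMatrixCubic_g0a]; norm_num, isIntegralUnitQuot_g0ab,
    by rw [det_mulMatrixCubic_g0ab]; norm_num, by norm_num, unitPairResidueIndependent_g0_11, Nat.one_pos, redeiNormEquation_g0⟩

/-- K325.7: DESC-46-R instantiated at the g0 data yields its `∃ r` conclusion (the row is USABLE: modus ponens goes through with the kernel-checked hypotheses). -/
theorem desc46R_at_g0 (h : UnitPlaneRedeiIncrementLawAtTwo) :
    ∃ r : ℤ, r ≠ 0 ∧ ∀ (W : WeierstrassCurve ℚ) [W.IsElliptic] [W.IsGloballyMinimal] [Fact (Irreducible (twoDivisionUCubic W))]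
      (xnum : ℤ[X]) (xden : ℕ) (B2 B4 B6 : ℤ), UnitPlaneSeedAtTwo W cubicG0 xnum xden B2 B4 B6 →
        ∀ q : ℕ, q.Prime → ¬ (q : ℤ) ∣ r → RigidThreeCycleTwist W q →
          (IncrementTrivialAtTwo W q ↔ (RedeiResidueIsSquareC cubicG0 unitG0a 1 1 1 q ↔ IsSquare ((r : ℤ) : ZMod q))) := by
  obtain ⟨h1, h2, h3, h4, h5, h6, h7, h8, h9, h10, h11⟩ := desc46R_hypotheses_g0
  exact h cubicG0 unitG0a unitG0ab 1 1 1 1 1 11 rootsG0mod11 h1 h2 h3 h4 h5 h6 h7 h8 h9 h10 h11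

end REF1_325

end Summit.BirchSwinnertonDyer.Rank1Residual.F1Sign2

end
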